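import Literature.Probability.Percolation.QuadCrossingNoise
import Literature.Probability.Percolation.QuadCrossingSubseqLimits
import Literature.Probability.Percolation.QuadCrossingPushforward
import Literature.Probability.Independence.BlackNoiseCriterion
import HarnessLib

/-!
# Schramm–Smirnov 2011, Cor. 1.8 (blackness): reduction to the noise property and the pivotal estimate

Topic `Literature/Probability/Percolation`; proofs file towards the named fact
`SchrammSmirnov2011_cor_1_8_black` of `QuadCrossingNoise.lean` (O. Schramm, S. Smirnov, *On the
scaling limits of planar percolation*, Ann. Probab. 39 (2011), arXiv:1101.5820, Cor. 1.8: "any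
subsequential scaling limit … is a noise … Therefore, it has to be a black noise, as explained in
[Ts03], Remark 8a2").  The source gives no further proof; Tsirelson's Remark 8a2
(arXiv:math/0301237, §8.1 Remark 137 with §6.5 Lemma 113 – Cor. 117) is: a first-chaos element
decomposes over the cells of any grid, and an `ε`-cell influences a crossing event only if it is
pivotal, which has probability `o(ε)`, "the sum … contains `O(1/ε²)` terms, `o(ε²)` each".

The measure-theoretic half of that argument is the tree's
`Literature/Probability/Independence/BlackNoiseCriterion.lean`.  This file instantiates it on
the Schramm–Smirnov space `ℋ_D` and PROVES the reduction of Cor. 1.8 (black) to its three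
percolation inputs, each stated here only as a HYPOTHESIS of the reduction theorem (no named fact
is introduced, D-0026):

1. the noise property `SchrammSmirnov2011_cor_1_8_noise` (independence of `𝓕_{int(D ∩ W)}` and
   `𝓕_{int(D ∖ W)}` for `W` in the rectangle base) — a named fact of `QuadCrossingNoise.lean`;
2. the factorization of adjacent pieces, `𝓕_{int(D ∩ (V ∪ W))} ⊆ 𝓕_{int(D ∩ V)} ∨ 𝓕_{int(D ∩ W)}`
   mod `μ` for disjoint `V, W` of the rectangle base — the content of Thm. 1.7 (Factorization)
   for the cut `∂V ∩ ∂W` (named fact `SchrammSmirnov2011_thm_1_7`, to be specialised);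
3. the pivotal estimate: every finite intersection `A` of crossing events is, for every `ε > 0`,
   sandwiched cell by cell, `A⁻_C ⊆ A ⊆ A⁺_C` with `A^±_C ∈ 𝓕_{int(D ∖ C)}`, over some finite
   partition of `ℂ` into members `C` of the rectangle base, with `Σ_C μ(A⁺_C ∖ A⁻_C)² ≤ ε²`
   (for an `ε`-grid: interior cells by the four-arm probability `O(ε^{1+η})`, Assumption 1.1
   (1.2) of the source = Appendix B of Garban for bond percolation on `ℤ²`; boundary cells by the
   half-plane three-arm probability; transported to the limit).

* `regionField_empty`, `regionField_mono` — the rectangle base indexes `σ`-fields monotonically,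
  `∅ ↦ ⊥`;
* (from `QuadCrossingSubseqLimits.lean`: a subsequential scaling limit is a probability measure,
  `isProbabilityMeasure_of_isSubseqQuadLimit`);
* `mem_gridSquare_iff`, `exists_finset_grid_partition` — the grids of Remark 8a2: for every
  offset, mesh `h > 0` and `N`, the `h`-squares of the box `[a - N h, a + N h) × [b - N h, b + N h)`
  and the complement of the box form a finite partition of `ℂ` into members of `rectAlgebra`
  (the partitions to feed into hypothesis 3);
* `borel_eq_generateFrom_generatePiSystem_crossedEvent` — the finite intersections of crossing
  events form a `π`-system generating the Borel `σ`-field (Thm. 1.4 (2),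
  `SchrammSmirnov2011_thm_1_4_holds`);
* `SchrammSmirnov2011_cor_1_8_black_of_noise` — **Cor. 1.8 (black) from 1–3**: by
  `ae_eq_sum_condExp_of_firstChaos` a first-chaos `f` decomposes over every finite partition of
  `ℂ` into members of the rectangle base, and `ae_eq_zero_of_forall_exists_cellDecomposition`
  concludes `f = 0` a.e.

## References

* O. Schramm, S. Smirnov, Ann. Probab. 39 (2011) 1768–1814, arXiv:1101.5820: §1.2
  Assumptions 1.1, Thm. 1.4 (2), Thm. 1.7, Cor. 1.8, App. B. [SchrammSmirnov2011]
* B. Tsirelson, *Scaling limit, noise, stability*, LNM 1840 (2004), arXiv:math/0301237, §6.5,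
  §8.1 Remark 137. [Tsirelson2003]
* B. Tsirelson, *Noise as a Boolean algebra of `σ`-fields*, Ann. Probab. 42 (2014), Def. 1.1–1.3.
  [Tsirelson2014]
-/

noncomputable section

open scoped unitInterval
open Set Filter
open _root_.MeasureTheory _root_.ProbabilityTheory _root_.Topology
open Literature.Probability.Independence

namespace Literature.Probability.Percolation

namespace QuadCrossing

variable {D : Set ℂ}

/-! ### The rectangle base indexes `σ`-fields monotonically -/

/-- The empty member of the base carries the trivial `σ`-field (no quad lies in `∅`). [folklore] -/
theorem regionField_empty (D : Set ℂ) : regionField D ∅ = (⊥ : MeasurableSpace (QuadConfig D)) := by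
  rw [regionField, inter_empty, interior_empty, crossingField]
  refine le_antisymm (MeasurableSpace.generateFrom_le ?_) bot_le
  rintro _ ⟨Q, hQ, rfl⟩
  exact absurd (hQ ⟨((0 : I), (0 : I)), rfl⟩) (notMem_empty _)

/-- `W ↦ 𝓕_{int(D ∩ W)}` is monotone. [folklore] -/
theorem regionField_mono (D : Set ℂ) {V W : Set ℂ} (h : V ⊆ W) : regionField D V ≤ regionField D W :=
  crossingField_mono (interior_mono (inter_subset_inter_right D h))

/-! ### Finite partitions of the plane by the rectangle base (grids) -/

/-- A point lies in the half-open `h`-square of the offset grid indexed by the integer parts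
`k = ⌊(re z - a)/h⌋`, `l = ⌊(im z - b)/h⌋`, and in no other. [folklore] -/
theorem mem_gridSquare_iff {a b h : ℝ} (hh : 0 < h) {k l : ℤ} {z : ℂ} :
    z ∈ {z : ℂ | a + k * h ≤ z.re ∧ z.re < a + (k + 1) * h ∧ b + l * h ≤ z.im ∧
        z.im < b + (l + 1) * h} ↔ k = ⌊(z.re - a) / h⌋ ∧ l = ⌊(z.im - b) / h⌋ := by
  rw [mem_setOf_eq, eq_comm (a := k), eq_comm (a := l), Int.floor_eq_iff, Int.floor_eq_iff,
    le_div_iff₀ hh, div_lt_iff₀ hh, le_div_iff₀ hh, div_lt_iff₀ hh]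
  constructor
  · rintro ⟨h1, h2, h3, h4⟩
    exact ⟨⟨by linarith, by linarith⟩, by linarith, by linarith⟩
  · rintro ⟨⟨h1, h2⟩, h3, h4⟩
    exact ⟨by linarith, by linarith, by linarith, by linarith⟩

/-- **Finite partitions of the plane by the rectangle base** (the grids of Tsirelson's Remark 8a2,
with an arbitrary offset `(a, b)` so that they can be put in general position with respect to
finitely many quads): for a mesh `h > 0` and `N`, the half-open `h`-squares
`[a + k h, a + (k+1) h) × [b + l h, b + (l+1) h)`, `-N ≤ k, l < N`, of the box
`[a - N h, a + N h) × [b - N h, b + N h)` together with the complement of the box form a finite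
partition of `ℂ` into members of `rectAlgebra`. [folklore] -/
theorem exists_finset_grid_partition (a b h : ℝ) (hh : 0 < h) (N : ℕ) :
    ∃ s : Finset (Set ℂ), (∀ C ∈ s, C ∈ rectAlgebra) ∧
      (∀ V ∈ s, ∀ W ∈ s, V ≠ W → Disjoint V W) ∧ (⋃ C ∈ s, C) = univ ∧
      {z : ℂ | a - N * h ≤ z.re ∧ z.re < a + N * h ∧ b - N * h ≤ z.im ∧ z.im < b + N * h}ᶜ ∈ s ∧
      ∀ C ∈ s, C = {z : ℂ | a - N * h ≤ z.re ∧ z.re < a + N * h ∧ b - N * h ≤ z.im ∧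
          z.im < b + N * h}ᶜ ∨
        ∃ k ∈ Finset.Ico (-(N : ℤ)) N, ∃ l ∈ Finset.Ico (-(N : ℤ)) N,
          C = {z : ℂ | a + k * h ≤ z.re ∧ z.re < a + (k + 1) * h ∧ b + l * h ≤ z.im ∧
            z.im < b + (l + 1) * h} := by
  classical
  set B : Set ℂ := {z : ℂ | a - N * h ≤ z.re ∧ z.re < a + N * h ∧ b - N * h ≤ z.im ∧
    z.im < b + N * h} with hB
  set S : ℤ → ℤ → Set ℂ := fun k l => {z : ℂ | a + k * h ≤ z.re ∧ z.re < a + (k + 1) * h ∧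
    b + l * h ≤ z.im ∧ z.im < b + (l + 1) * h} with hS
  set T : Finset ℤ := Finset.Ico (-(N : ℤ)) N with hT
  set sq : Finset (Set ℂ) := (T ×ˢ T).image fun p => S p.1 p.2 with hsq
  -- squares of the box lie in the box
  have hSB : ∀ k ∈ T, ∀ l ∈ T, S k l ⊆ B := by
    intro k hk l hl
    rw [hT, Finset.mem_Ico] at hk hl
    have hk1 : (-(N : ℝ)) ≤ k := by exact_mod_cast hk.1
    have hk2 : (k : ℝ) + 1 ≤ N := by exact_mod_cast hk.2
    have hl1 : (-(N : ℝ)) ≤ l := by exact_mod_cast hl.1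
    have hl2 : (l : ℝ) + 1 ≤ N := by exact_mod_cast hl.2
    rintro z ⟨h1, h2, h3, h4⟩
    refine ⟨?_, ?_, ?_, ?_⟩ <;> nlinarith
  -- the box is covered by its squares
  have hBS : ∀ z ∈ B, ∃ k ∈ T, ∃ l ∈ T, z ∈ S k l := by
    rintro z ⟨h1, h2, h3, h4⟩
    refine ⟨⌊(z.re - a) / h⌋, ?_, ⌊(z.im - b) / h⌋, ?_, (mem_gridSquare_iff hh).2 ⟨rfl, rfl⟩⟩
    · rw [hT, Finset.mem_Ico, Int.le_floor, Int.floor_lt]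
      push_cast
      rw [le_div_iff₀ hh, div_lt_iff₀ hh]
      constructor <;> linarith
    · rw [hT, Finset.mem_Ico, Int.le_floor, Int.floor_lt]
      push_cast
      rw [le_div_iff₀ hh, div_lt_iff₀ hh]
      constructor <;> linarith
  -- distinct squares are disjoint
  have hdisjS : ∀ k l k' l', (k, l) ≠ (k', l') → Disjoint (S k l) (S k' l') := by
    intro k l k' l' hne
    rw [Set.disjoint_left]
    intro z hz hz'
    obtain ⟨e1, e2⟩ := (mem_gridSquare_iff hh).1 hz
    obtain ⟨e1', e2'⟩ := (mem_gridSquare_iff hh).1 hz'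
    exact hne (by rw [e1, e2, e1', e2'])
  have hsqB : ∀ C ∈ sq, C ⊆ B := by
    intro C hC
    obtain ⟨p, hp, rfl⟩ := Finset.mem_image.1 hC
    rw [Finset.mem_product] at hp
    exact hSB p.1 hp.1 p.2 hp.2
  refine ⟨insert Bᶜ sq, ?_, ?_, ?_, Finset.mem_insert_self _ _, ?_⟩
  · intro C hC
    rcases Finset.mem_insert.1 hC with rfl | hC
    · exact compl_mem_rectAlgebra (rect_mem_rectAlgebra _ _ _ _)
    · obtain ⟨p, -, rfl⟩ := Finset.mem_image.1 hC
      exact rect_mem_rectAlgebra _ _ _ _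
  · intro V hV W hW hVW
    rcases Finset.mem_insert.1 hV with rfl | hV'
    · rcases Finset.mem_insert.1 hW with rfl | hW'
      · exact absurd rfl hVW
      · exact Set.disjoint_left.2 fun z hz hzW => hz (hsqB W hW' hzW)
    · rcases Finset.mem_insert.1 hW with rfl | hW'
      · exact Set.disjoint_left.2 fun z hzV hz => hz (hsqB V hV' hzV)
      · obtain ⟨p, -, rfl⟩ := Finset.mem_image.1 hV'
        obtain ⟨q, -, rfl⟩ := Finset.mem_image.1 hW'
        refine hdisjS _ _ _ _ fun hpq => hVW ?_
        rw [Prod.ext_iff] at hpq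
        simp only at hpq
        rw [hpq.1, hpq.2]
  · refine Set.eq_univ_of_forall fun z => ?_
    rw [Set.mem_iUnion₂]
    by_cases hz : z ∈ B
    · obtain ⟨k, hk, l, hl, hz'⟩ := hBS z hz
      exact ⟨S k l, Finset.mem_insert_of_mem
        (Finset.mem_image.2 ⟨(k, l), Finset.mem_product.2 ⟨hk, hl⟩, rfl⟩), hz'⟩
    · exact ⟨Bᶜ, Finset.mem_insert_self _ _, hz⟩
  · intro C hC
    rcases Finset.mem_insert.1 hC with rfl | hC
    · exact Or.inl rfl
    · obtain ⟨p, hp, rfl⟩ := Finset.mem_image.1 hC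
      rw [Finset.mem_product] at hp
      exact Or.inr ⟨p.1, hp.1, p.2, hp.2, rfl⟩

/-! ### The generating `π`-system of finite intersections of crossing events -/

/-- For `D` open nonempty, the Borel `σ`-field of `ℋ_D` is generated by the `π`-system of finite
(nonempty) intersections of crossing events `⊞_Q` (Thm. 1.4 (2): `σ(⊞_Q : Q ∈ 𝒬_D)` is the Borel
`σ`-field). [cite: SchrammSmirnov2011, Thm. 1.4 (2)] -/
theorem borel_eq_generateFrom_generatePiSystem_crossedEvent (hD : IsOpen D) (hne : D.Nonempty) :
    (QuadConfig.instMeasurableSpace : MeasurableSpace (QuadConfig D)) =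
      MeasurableSpace.generateFrom
        (generatePiSystem (range (QuadConfig.crossedEvent (D := D)))) := by
  rw [generateFrom_generatePiSystem_eq]
  have h := QuadConfig.crossingSubfield_univ_eq_borel (D := D) SchrammSmirnov2011_thm_1_4_holds hD hne
  have hset : {A : Set (QuadConfig D) | ∃ Q : Quad D, Q.carrier ⊆ univ ∧ A = QuadConfig.crossedEvent Q}
      = range (QuadConfig.crossedEvent (D := D)) := by
    ext A
    constructor
    · rintro ⟨Q, -, rfl⟩
      exact ⟨Q, rfl⟩
    · rintro ⟨Q, rfl⟩
      exact ⟨Q, subset_univ _, rfl⟩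
  change borel (QuadConfig D) = _
  rw [← h, QuadConfig.crossingSubfield, hset]

/-! ### Cor. 1.8 (black) from the noise property, factorization and the pivotal estimate -/

/-- **Schramm–Smirnov 2011, Cor. 1.8 "it has to be a black noise", reduced to its percolation
inputs.**  Assume (1) the noise property `SchrammSmirnov2011_cor_1_8_noise` (independence of the
`σ`-fields of `int(D ∩ W)` and `int(D ∖ W)`, `W` in the rectangle base); (2) the factorization of
adjacent pieces of the base, `𝓕_{int(D ∩ (V ∪ W))} ⊆ 𝓕_{int(D ∩ V)} ∨ 𝓕_{int(D ∩ W)}` up to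
`μ`-null sets for disjoint `V, W ∈ rectAlgebra` (Thm. 1.7 for the cut between them); (3) the
pivotal estimate: for every finite intersection `A` of crossing events and every `ε > 0` there is a
finite partition of `ℂ` into members `C` of the base and events `A⁻_C ⊆ A ⊆ A⁺_C` (a.e.) of
`𝓕_{int(D ∖ C)}` with `Σ_C μ(A⁺_C ∖ A⁻_C)² ≤ ε²` ("the critical exponent for a small cell of size
`ε × ε` being pivotal … `o(ε)` … `O(1/ε²)` terms, `o(ε²)` each", Tsirelson's Remark 8a2 cited by the
source).  Then every subsequential scaling limit is black in the sense of
`SchrammSmirnov2011_cor_1_8_black`: its first chaos over the rectangle base is `{0}`.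
Proof: Tsirelson's argument, `ae_eq_sum_condExp_of_firstChaos` (cell decomposition of a
first-chaos element, from (1)–(2)) and `ae_eq_zero_of_forall_exists_cellDecomposition` (the
pivotal bound `∫ (E[𝟙_A | 𝓕_C] − μ A)² ≤ μ(A⁺_C ∖ A⁻_C)²` and the `π`-`λ` conclusion, with (3)).
[cite: SchrammSmirnov2011, Cor. 1.8 (via Tsirelson2003 Remark 8a2 = §8.1 Remark 137 of arXiv math/0301237)] -/
theorem SchrammSmirnov2011_cor_1_8_black_of_noise (hnoise : SchrammSmirnov2011_cor_1_8_noise)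
    (hfac : ∀ (D : Set ℂ), IsOpen D → IsConnected D →
      ∀ μ : FiniteMeasure (QuadConfig D), IsSubseqQuadLimit D μ →
        ∀ V ∈ rectAlgebra, ∀ W ∈ rectAlgebra, Disjoint V W →
          AEIncluded (μ : Measure (QuadConfig D)) (regionField D (V ∪ W))
            (regionField D V ⊔ regionField D W))
    (hpiv : ∀ (D : Set ℂ), IsOpen D → IsConnected D →
      ∀ μ : FiniteMeasure (QuadConfig D), IsSubseqQuadLimit D μ →
        ∀ A ∈ generatePiSystem (range (QuadConfig.crossedEvent (D := D))), ∀ ε : ℝ, 0 < ε →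
          ∃ s : Finset (Set ℂ), (∀ W ∈ s, W ∈ rectAlgebra) ∧
            (∀ V ∈ s, ∀ W ∈ s, V ≠ W → Disjoint V W) ∧ (⋃ W ∈ s, W) = univ ∧
            ∃ Am Ap : Set ℂ → Set (QuadConfig D),
              (∀ W ∈ s, MeasurableSet[regionField D Wᶜ] (Am W) ∧
                MeasurableSet[regionField D Wᶜ] (Ap W) ∧
                (∀ᵐ ω ∂(μ : Measure (QuadConfig D)), ω ∈ Am W → ω ∈ A) ∧
                (∀ᵐ ω ∂(μ : Measure (QuadConfig D)), ω ∈ A → ω ∈ Ap W)) ∧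
              ∑ W ∈ s, ((μ : Measure (QuadConfig D)).real (Ap W \ Am W)) ^ 2 ≤ ε ^ 2) :
    SchrammSmirnov2011_cor_1_8_black := by
  classical
  intro D hD hDc μ hμ f hf hchaos
  have hne : D.Nonempty := hDc.nonempty
  haveI : IsProbabilityMeasure (μ : Measure (QuadConfig D)) :=
    isProbabilityMeasure_of_isSubseqQuadLimit hD hμ
  have hgen := borel_eq_generateFrom_generatePiSystem_crossedEvent hD hne
  have hle : ∀ W : Set ℂ, regionField D W ≤ (QuadConfig.instMeasurableSpace :
      MeasurableSpace (QuadConfig D)) := fun W => crossingField_le _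
  have hf0 : ∫ ω, f ω ∂(μ : Measure (QuadConfig D)) = 0 :=
    integral_eq_zero_of_ae_eq_condExp_add (hle univ) (hle univᶜ)
      (hchaos univ univ_mem_rectAlgebra)
  refine ae_eq_zero_of_forall_exists_cellDecomposition (fun W => regionField D W)
    (fun W => regionField D Wᶜ) hgen (isPiSystem_generatePiSystem _) hf hf0 ?_
  intro A hA ε hε
  obtain ⟨s, hs𝒜, hdisj, hcover, Am, Ap, hsand, hsum⟩ := hpiv D hD hDc μ hμ A hA ε hε
  refine ⟨s, fun W hW => ⟨hle W, hle Wᶜ, (hnoise D hD hDc μ hμ W (hs𝒜 W hW)).1⟩, ?_, Am, Ap,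
    hsand, hsum⟩
  have hdec := (ae_eq_sum_condExp_of_firstChaos (μ := (μ : Measure (QuadConfig D)))
    isSetAlgebra_rectAlgebra (fun W => regionField D W) (fun W _ => hle W)
    (fun V _ W _ hVW => regionField_mono D hVW) (fun W hW => (hnoise D hD hDc μ hμ W hW).1)
    (fun V hV W hW hVW => hfac D hD hDc μ hμ V hV W hW hVW) (regionField_empty D) hchaos id s
    (fun W hW => hs𝒜 W hW) hdisj (by simpa using hcover)).1
  simpa using hdec

end QuadCrossing

end Literature.Probability.Percolation
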